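/-
Copyright (c) 2026 the pub-hodgecm-mathlib formalisation cell (harness21).  Prover seat hodgecm-mathlib-K2E1-p11 (g2), Track B ∕ K2-LIT, h413 =
`stmt-HodgeConjecture-24833`, line `K2_E1_TraceFormulaBeta`, 5Res campaign «ENDGAME BY FAMILIES» ∕ ROADCARD §3′ (M2 v2), K2E4-p23's SD-package input (15:08:40Z): the ALL-OF-`H`
self-dual intertwining — the SD twin of ★ (y2) `hU_offDual_global_cm_two`: from the closed-span statement of ★ `hU_selfDual_of_generators` ∕ ★ `hU_selfDual_cm_two` and `T†(Θ) ⊆ Θ`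
to `U(Tv) = (diag s ⊕ M_σ)(U v)` for EVERY `v`, `U = U_iso ∘ P_Θ` the global model map (★ p860498).  Generic (any Hilbert `H`, finite-dimensional `W`).
-/
import Summits.HodgeConjecture.HodgeConjecture.Theorems.K2E1SelfDualModelHeckeIntertwining           -- ★ (y1-c) p860878 (this seat): `exists_prodMultiplier`
import Summits.HodgeConjecture.HodgeConjecture.Theorems.K2E1ChiSectionHeckeIntertwiningGlobalCMTwo  -- ★ (y2) p860682 (this seat): `modelMap_map_eq_of_on_closedSpan`; brings ★ p860498 modelMap
import HarnessLib

/-!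
# `K2E1SelfDualModelHeckeIntertwiningGlobal`: `U(Tv) = ((s(c)•(Uv)_c)_c, σ•(Uv)_cont)` on ALL of `H` for the global model map of a self-dual block

Cell `pub/hodgecm-mathlib`, crux H413 = `stmt-HodgeConjecture-24833`, route `HCCMUnconditional`; K2E4-p23 (g2) 15:08:40Z SD-package input («the ALL-OF-H self-dual intertwining on THIS Uiso»),
dealer K2E1-plan (g7) (255)∕(272).  THEOREMS ONLY (no `def` ∕ `instance` ∕ `notation` ∕ named-fact hypothesis ∕ `sorry`); lane `--kind proof --supports stmt-HodgeConjecture-24833 --as helper`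
(count-neutral; closes no socket).
THE MATHEMATICS ([ReedSimonI1980, Thm. II.3]; [MoeglinWaldspurger1995, II.2.4]).  `Θ = closure span {x_i} ≤ H`, `U_iso : Θ →ₗᵢ (⊕_c W) ⊕₂ L²(m; W)`, `U = U_iso ∘ P_Θ`.  HYPOTHESES: the
closed-span statement `hon : ∀ v ∈ Θ, ∃ hTv, U_iso(Tv) = ((s(c)•(U_iso v)_c)_c, σ•(U_iso v)_cont)` (= the OUTPUT of ★ `hU_selfDual_of_generators` ∕ ★ `hU_selfDual_cm_two`) and `hTadjΘ :
T†(Θ) ⊆ Θ` (★ `hadjΘ_of_symm`).  CONCLUSION: the same identity for `U` and EVERY `v ∈ H` — the model multiplier is a bounded operator `Mop` (★ `exists_prodMultiplier`), so ★ (y2)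
`modelMap_map_eq_of_on_closedSpan` (`T(Θᗮ) ⊆ Θᗮ`, `U(Θᗮ) = 0`) applies with `S := Mop`.
* **`hU_selfDual_global`**.
HONEST LABEL.  Count-neutral helper; proves no printed statement; Mathlib + ★ only.  HC_CM is proved only modulo the 7 printed citations (2 remaining named inputs: hLiu418 =
`stmt-HodgeConjecture-24832`, h413 = `stmt-HodgeConjecture-24833`) until rung 0 closes.

## References
* [ReedSimonI1980] M. Reed, B. Simon, *Methods of Modern Mathematical Physics I* (1980), Thm. II.3.
* [MoeglinWaldspurger1995] C. Mœglin, J.-L. Waldspurger, *Spectral decomposition and Eisenstein series* (1995), II.2.4.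
-/

set_option autoImplicit false
-- the mandated namespace repeats `HodgeConjecture.HodgeConjecture`, as in every `Theorems/*.lean` of this sub-problem
set_option linter.dupNamespace false

noncomputable section

open MeasureTheory Set Submodule
open scoped ENNReal
open Summit.HodgeConjecture.HodgeConjecture.Cruxes.H413.K2E1PlancherelModelMapOfIsometry (completeSpace_topologicalClosure_span)
open Summit.HodgeConjecture.HodgeConjecture.Cruxes.H413.K2E1SelfDualModelHeckeIntertwining (exists_prodMultiplier)
open Summit.HodgeConjecture.HodgeConjecture.Cruxes.H413.K2E1ChiSectionHeckeIntertwiningGlobalCMTwo (modelMap_map_eq_of_on_closedSpan)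

namespace Summit.HodgeConjecture.HodgeConjecture.Cruxes.H413.K2E1SelfDualModelHeckeIntertwiningGlobal

variable {ι H W : Type*} [NormedAddCommGroup H] [InnerProductSpace ℂ H] [CompleteSpace H] [NormedAddCommGroup W] [InnerProductSpace ℂ W] [FiniteDimensional ℂ W]

/-- **THE ALL-OF-`H` SELF-DUAL INTERTWINING**: `U(Tv) = ((s(c)•(U v)_c)_c, σ•(U v)_cont)` for EVERY `v ∈ H`, `U = U_iso ∘ P_Θ`, from the closed-span statement (★ `hU_selfDual_of_generators`'s
output) and `T†(Θ) ⊆ Θ`. [cite: ReedSimonI1980, Thm. II.3] [cite: MoeglinWaldspurger1995, II.2.4] -/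
theorem hU_selfDual_global {X : Type*} [MeasurableSpace X] {m : Measure X} [ENNReal.HolderTriple ∞ 2 2] {γ : Type*} [Fintype γ]
    (x : ι → H) (Uiso : ↥(span ℂ (Set.range x)).topologicalClosure →ₗᵢ[ℂ] WithLp 2 (PiLp 2 (fun _ : γ => W) × Lp W 2 m))
    (T : H →L[ℂ] H) (s : γ → ℂ) {σ : X → ℂ} (hσ : MemLp σ ∞ m)
    (hon : ∀ (v : H) (hv : v ∈ (span ℂ (Set.range x)).topologicalClosure), ∃ hTv : T v ∈ (span ℂ (Set.range x)).topologicalClosure,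
      Uiso ⟨T v, hTv⟩ = WithLp.toLp 2 (WithLp.toLp 2 (fun c => s c • (Uiso ⟨v, hv⟩).fst c), (hσ.toLp σ : Lp ℂ ∞ m) • (Uiso ⟨v, hv⟩).snd))
    (hTadjΘ : ∀ v ∈ (span ℂ (Set.range x)).topologicalClosure, ContinuousLinearMap.adjoint T v ∈ (span ℂ (Set.range x)).topologicalClosure) (v : H) :
    haveI := completeSpace_topologicalClosure_span x
    (Uiso.toContinuousLinearMap.comp (span ℂ (Set.range x)).topologicalClosure.orthogonalProjectionOnto) (T v) =
      WithLp.toLp 2 (WithLp.toLp 2 (fun c => s c • ((Uiso.toContinuousLinearMap.comp (span ℂ (Set.range x)).topologicalClosure.orthogonalProjectionOnto) v).fst c),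
        (hσ.toLp σ : Lp ℂ ∞ m) • ((Uiso.toContinuousLinearMap.comp (span ℂ (Set.range x)).topologicalClosure.orthogonalProjectionOnto) v).snd) := by
  haveI := completeSpace_topologicalClosure_span x
  obtain ⟨Mop, hMop⟩ := exists_prodMultiplier (W := W) (m := m) s hσ
  -- `Mop z` on components, for any `z` of the model space
  have hMop' : ∀ z : WithLp 2 (PiLp 2 (fun _ : γ => W) × Lp W 2 m),
      Mop z = WithLp.toLp 2 (WithLp.toLp 2 (fun c => s c • z.fst c), (hσ.toLp σ : Lp ℂ ∞ m) • z.snd) := fun z => hMop z.fst z.snd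
  have hTΘ : ∀ v ∈ (span ℂ (Set.range x)).topologicalClosure, T v ∈ (span ℂ (Set.range x)).topologicalClosure := fun v hv => (hon v hv).1
  have hon' : ∀ (v : H) (hv : v ∈ (span ℂ (Set.range x)).topologicalClosure), Uiso ⟨T v, hTΘ v hv⟩ = Mop (Uiso ⟨v, hv⟩) := fun v hv => by
    rw [hMop']
    exact (hon v hv).2
  rw [modelMap_map_eq_of_on_closedSpan x Uiso T Mop hTΘ hTadjΘ hon' v, hMop']

end Summit.HodgeConjecture.HodgeConjecture.Cruxes.H413.K2E1SelfDualModelHeckeIntertwiningGlobal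

end
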